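import Summits.ResolutionOfSingularities.ResolutionOfSingularities.Theorems.FrobeniusLadderFInjectiveMacaulayficationHWeightedData
import Mathlib.RingTheory.MvPolynomial.WeightedHomogeneous
import Mathlib.Algebra.MvPolynomial.PDeriv
import Mathlib.Algebra.MvPolynomial.Equiv
import Mathlib.Algebra.Polynomial.Degree.Domain
import Mathlib.RingTheory.Polynomial.UniqueFactorization
import HarnessLib

/-!
# The `d = 4` specimen `G_xz = z² + (y² + x³)³ + w⁷ + t²xz` (diagonal form `g = z² + x²t⁴ + (y² + x³)³ + w⁷`) as a
# `(28,42,126,36,49)`-GRADED specimen: characteristic-free data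
# (crux `FInjectiveMacaulayfication`, line (Q) / graded engine G5; campaign G_xz/5, RULING R15.14 (1) of res-L1-w45a-plan-1)

Support file for crux stmt-ResolutionOfSingularities-15315 (`FrobeniusLadder.FInjectiveMacaulayfication`), chain w45a, seat
res-L1-w45a-stub-4 g6 (campaign owner). [OURS · L1 W4.5a; specimen label `G_xz` = res-L1-w45a-idea-2 RESULT-5/6 (GFAN–FEDDER scan
row, cover check j284996), booked RULING R15.1 (3); templates `G5wData` (res-L1-w45a-stub-3) and `E8WeightedData`] — NOT a statement of
the manuscript [claim: Hironaka2017]; AI-written, weaker than expert review.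

`G_xz := X₂² + (X₁² + X₀³)³ + X₃⁷ + X₄²X₀X₂ ⊂ 𝔸⁵` (`X₀ = x, X₁ = y, X₂ = z, X₃ = w, X₄ = t`; the threefold-point `T₁₁` plus the
cross term `t²xz`) is QUASI-HOMOGENEOUS for `w = (28, 42, 126, 36, 49)` of weight `252` (all four monomial types weigh `252`), so the
GRADED engine G5 `GradedConeFiModel.stub_gradedConeFiModel` applies to it directly (`N = lcm = 1764`, `c = (63, 42, 14, 49, 36)`).
In characteristic `5` the graded coordinate change `z ↦ z − 3t²x` (weight of `t²x` = `126` = weight of `z`) carries `G_xz` to its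
DIAGONAL FORM `g := X₂² + X₀²X₄⁴ + (X₁² + X₀³)³ + X₃⁷` (`(z − 3t²x)² + t²x(z − 3t²x) = z² − 5t²xz + 6t⁴x² ≡ z² + x²t⁴`), which has
no cross term; the campaign computes with `g` and transports to `G_xz` at the end (`…GxzGradedFiModel`).  This file: the
characteristic-free data of `g` for the engine —

* `g_isWeightedHomogeneous` (weight `252`), `g_ne_zero`;
* `prime_gxz` — `g` is prime over EVERY field and divides no variable (`k[X₀,…,X₄] ≃ k[Y₀,…,Y₃][T]`, `X₂ ↦ T`; `g ↦ T² + c` with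
  `c(0,0,T,0) = T⁷` of odd degree: `HWeightedData.mul_self_ne_neg_of_odd_natDegree` + `E8Forms.prime_and_not_dvd_of_ringEquiv`),
  `span_gxz_isPrime`, `gxz_X_ne_zero`;
* the five partial derivatives of `g` (`∂₀ = 2X₀X₄⁴ + 9X₀²φ²`, `∂₁ = 6X₁φ²`, `∂₂ = 2X₂`, `∂₃ = 7X₃⁶`, `∂₄ = 4X₀²X₄³`, `φ = X₁² + X₀³`),
  used by `…GxzOffOrigin` to locate the singular locus `L ∪ C` (`L` = the `t`-axis, `C` = the cuspidal curve `{z = w = t = 0, φ = 0}`).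

All proofs are glue on Mathlib and landed files; no definitions, no named facts. [folklore]
-/

-- single-problem summit: the doubled namespace component is forced
set_option linter.dupNamespace false

noncomputable section

namespace Summit.ResolutionOfSingularities.ResolutionOfSingularities.Theorems.FInjectiveMacaulayfication.GxzData

open MvPolynomial
open Summit.ResolutionOfSingularities.ResolutionOfSingularities.Theorems.FInjectiveMacaulayfication

/-! ## Weighted homogeneity -/

/-- `g = X₂² + X₀²X₄⁴ + (X₁² + X₀³)³ + X₃⁷` is `(28,42,126,36,49)`-weighted-homogeneous of weight `252`. [folklore] -/
theorem g_isWeightedHomogeneous (k : Type) [Field k] :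
    MvPolynomial.IsWeightedHomogeneous (![28, 42, 126, 36, 49] : Fin 5 → ℕ)
      (X 2 ^ 2 + X 0 ^ 2 * X 4 ^ 4 + (X 1 ^ 2 + X 0 ^ 3) ^ 3 + X 3 ^ 7 : MvPolynomial (Fin 5) k) 252 := by
  have hX := fun j : Fin 5 => isWeightedHomogeneous_X k (![28, 42, 126, 36, 49] : Fin 5 → ℕ) j
  have hφ : IsWeightedHomogeneous (![28, 42, 126, 36, 49] : Fin 5 → ℕ) (X 1 ^ 2 + X 0 ^ 3 : MvPolynomial (Fin 5) k) 84 := by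
    refine IsWeightedHomogeneous.add ?_ ?_
    · simpa using (hX 1).pow 2
    · simpa using (hX 0).pow 3
  refine (((?_ : IsWeightedHomogeneous _ _ 252).add ?_).add ?_).add ?_
  · simpa using (hX 2).pow 2
  · simpa using ((hX 0).pow 2).mul ((hX 4).pow 4)
  · simpa using hφ.pow 3
  · simpa using (hX 3).pow 7

/-- `g ≠ 0` (it takes the value `1` at `(0,0,1,0,0)`). [folklore] -/
theorem g_ne_zero (k : Type) [Field k] :
    (X 2 ^ 2 + X 0 ^ 2 * X 4 ^ 4 + (X 1 ^ 2 + X 0 ^ 3) ^ 3 + X 3 ^ 7 : MvPolynomial (Fin 5) k) ≠ 0 := by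
  intro h0
  have h1 := congrArg (MvPolynomial.eval ![(0 : k), 0, 1, 0, 0]) h0
  simp at h1

/-! ## Primality over every field -/

/-- **`g` is prime over every field and divides no variable** (`k[X₀,…,X₄] ≃ k[Y₀,…,Y₃][T]`, `X₂ ↦ T`, `X₀ ↦ C Y₁`, `X₁ ↦ C Y₀`,
`X₃ ↦ C Y₂`, `X₄ ↦ C Y₃`; `g ↦ T² + c`, `c(0,0,T,0) = T⁷` has odd degree). [folklore] -/
theorem prime_gxz (k : Type) [Field k] (g : MvPolynomial (Fin 5) k)
    (hg : g = X 2 ^ 2 + X 0 ^ 2 * X 4 ^ 4 + (X 1 ^ 2 + X 0 ^ 3) ^ 3 + X 3 ^ 7) :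
    Prime g ∧ ∀ v : Fin 5, ¬ g ∣ MvPolynomial.X v := by
  obtain ⟨e, he0, he1, he2, he3, he4⟩ : ∃ e : MvPolynomial (Fin 5) k ≃+* Polynomial (MvPolynomial (Fin 4) k),
      e (X 0) = Polynomial.C (X 1) ∧ e (X 1) = Polynomial.C (X 0) ∧ e (X 2) = Polynomial.X ∧
        e (X 3) = Polynomial.C (X 2) ∧ e (X 4) = Polynomial.C (X 3) := by
    refine ⟨((renameEquiv k (Equiv.swap (0 : Fin 5) 2)).trans (finSuccEquiv k 4)).toRingEquiv, ?_, ?_, ?_, ?_, ?_⟩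
    · show finSuccEquiv k 4 (rename (Equiv.swap (0 : Fin 5) 2) (X 0)) = _
      rw [rename_X, Equiv.swap_apply_left]
      exact finSuccEquiv_X_succ (j := 1)
    · show finSuccEquiv k 4 (rename (Equiv.swap (0 : Fin 5) 2) (X 1)) = _
      rw [rename_X, Equiv.swap_apply_of_ne_of_ne (by decide) (by decide)]
      exact finSuccEquiv_X_succ (j := 0)
    · show finSuccEquiv k 4 (rename (Equiv.swap (0 : Fin 5) 2) (X 2)) = _
      rw [rename_X, Equiv.swap_apply_right]
      exact finSuccEquiv_X_zero
    · show finSuccEquiv k 4 (rename (Equiv.swap (0 : Fin 5) 2) (X 3)) = _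
      rw [rename_X, Equiv.swap_apply_of_ne_of_ne (by decide) (by decide)]
      exact finSuccEquiv_X_succ (j := 2)
    · show finSuccEquiv k 4 (rename (Equiv.swap (0 : Fin 5) 2) (X 4)) = _
      rw [rename_X, Equiv.swap_apply_of_ne_of_ne (by decide) (by decide)]
      exact finSuccEquiv_X_succ (j := 3)
  have heg : e g = Polynomial.X ^ 2 +
      Polynomial.C (X 1 ^ 2 * X 3 ^ 4 + (X 0 ^ 2 + X 1 ^ 3) ^ 3 + X 2 ^ 7 : MvPolynomial (Fin 4) k) := by
    subst hg
    simp only [map_add, map_mul, map_pow, he0, he1, he2, he3, he4]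
    ring
  have hc : ∀ a : MvPolynomial (Fin 4) k, a * a ≠ -(X 1 ^ 2 * X 3 ^ 4 + (X 0 ^ 2 + X 1 ^ 3) ^ 3 + X 2 ^ 7) := by
    refine HWeightedData.mul_self_ne_neg_of_odd_natDegree ![0, 0, Polynomial.X, 0] ?_
    have hv : MvPolynomial.aeval (![0, 0, Polynomial.X, 0] : Fin 4 → Polynomial k)
        (X 1 ^ 2 * X 3 ^ 4 + (X 0 ^ 2 + X 1 ^ 3) ^ 3 + X 2 ^ 7 : MvPolynomial (Fin 4) k) = Polynomial.X ^ 7 := by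
      simp only [map_add, map_mul, map_pow, MvPolynomial.aeval_X, Matrix.cons_val_zero, Matrix.cons_val_one, Matrix.cons_val]
      norm_num
    rw [hv, Polynomial.natDegree_X_pow]
    decide
  obtain ⟨hp, hnd⟩ := E8Forms.prime_and_not_dvd_of_ringEquiv e g _ heg hc
  refine ⟨hp, fun v => ?_⟩
  fin_cases v
  · exact hnd (X 0) (X 1) (X_ne_zero 1) he0
  · exact hnd (X 1) (X 0) (X_ne_zero 0) he1
  · rintro ⟨q, hq⟩
    have h1 : (Polynomial.X ^ 2 + Polynomial.C (X 1 ^ 2 * X 3 ^ 4 + (X 0 ^ 2 + X 1 ^ 3) ^ 3 + X 2 ^ 7) :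
        Polynomial (MvPolynomial (Fin 4) k)) ∣ Polynomial.X :=
      ⟨e q, by rw [← heg, ← map_mul, ← hq]; exact he2.symm⟩
    have h2 := Polynomial.natDegree_le_of_dvd h1 Polynomial.X_ne_zero
    rw [Polynomial.natDegree_X_pow_add_C, Polynomial.natDegree_X] at h2
    omega
  · exact hnd (X 3) (X 2) (X_ne_zero 2) he3
  · exact hnd (X 4) (X 3) (X_ne_zero 3) he4

/-- `(g)` is a prime ideal. [folklore] -/
theorem span_gxz_isPrime (k : Type) [Field k] (g : MvPolynomial (Fin 5) k)
    (hg : g = X 2 ^ 2 + X 0 ^ 2 * X 4 ^ 4 + (X 1 ^ 2 + X 0 ^ 3) ^ 3 + X 3 ^ 7) : (Ideal.span {g}).IsPrime :=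
  (Ideal.span_singleton_prime (prime_gxz k g hg).1.ne_zero).mpr (prime_gxz k g hg).1

/-- No variable lies in `(g)`. [folklore] -/
theorem gxz_X_ne_zero (k : Type) [Field k] (g : MvPolynomial (Fin 5) k)
    (hg : g = X 2 ^ 2 + X 0 ^ 2 * X 4 ^ 4 + (X 1 ^ 2 + X 0 ^ 3) ^ 3 + X 3 ^ 7) (v : Fin 5) :
    Ideal.Quotient.mk (Ideal.span {g}) (MvPolynomial.X v) ≠ 0 := fun h0 =>
  (prime_gxz k g hg).2 v (Ideal.mem_span_singleton.mp (Ideal.Quotient.eq_zero_iff_mem.mp h0))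

/-! ## Partial derivatives -/

/-- `∂₀ g = 2X₀X₄⁴ + 9X₀²(X₁² + X₀³)²`. [folklore] -/
theorem pderiv_zero_gxz {A : Type*} [CommRing A] :
    pderiv 0 (X 2 ^ 2 + X 0 ^ 2 * X 4 ^ 4 + (X 1 ^ 2 + X 0 ^ 3) ^ 3 + X 3 ^ 7 : MvPolynomial (Fin 5) A) =
      2 * X 0 * X 4 ^ 4 + 9 * X 0 ^ 2 * (X 1 ^ 2 + X 0 ^ 3) ^ 2 := by
  simp only [map_add, Derivation.leibniz, pderiv_pow, pderiv_X_self, smul_eq_mul,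
    pderiv_X_of_ne (show (1 : Fin 5) ≠ 0 by decide), pderiv_X_of_ne (show (2 : Fin 5) ≠ 0 by decide),
    pderiv_X_of_ne (show (3 : Fin 5) ≠ 0 by decide), pderiv_X_of_ne (show (4 : Fin 5) ≠ 0 by decide)]
  norm_num
  ring

/-- `∂₁ g = 6X₁(X₁² + X₀³)²`. [folklore] -/
theorem pderiv_one_gxz {A : Type*} [CommRing A] :
    pderiv 1 (X 2 ^ 2 + X 0 ^ 2 * X 4 ^ 4 + (X 1 ^ 2 + X 0 ^ 3) ^ 3 + X 3 ^ 7 : MvPolynomial (Fin 5) A) =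
      6 * X 1 * (X 1 ^ 2 + X 0 ^ 3) ^ 2 := by
  simp only [map_add, Derivation.leibniz, pderiv_pow, pderiv_X_self, smul_eq_mul,
    pderiv_X_of_ne (show (0 : Fin 5) ≠ 1 by decide), pderiv_X_of_ne (show (2 : Fin 5) ≠ 1 by decide),
    pderiv_X_of_ne (show (3 : Fin 5) ≠ 1 by decide), pderiv_X_of_ne (show (4 : Fin 5) ≠ 1 by decide)]
  norm_num
  ring

/-- `∂₂ g = 2X₂`. [folklore] -/
theorem pderiv_two_gxz {A : Type*} [CommRing A] :
    pderiv 2 (X 2 ^ 2 + X 0 ^ 2 * X 4 ^ 4 + (X 1 ^ 2 + X 0 ^ 3) ^ 3 + X 3 ^ 7 : MvPolynomial (Fin 5) A) = 2 * X 2 := by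
  simp only [map_add, Derivation.leibniz, pderiv_pow, pderiv_X_self, smul_eq_mul,
    pderiv_X_of_ne (show (0 : Fin 5) ≠ 2 by decide), pderiv_X_of_ne (show (1 : Fin 5) ≠ 2 by decide),
    pderiv_X_of_ne (show (3 : Fin 5) ≠ 2 by decide), pderiv_X_of_ne (show (4 : Fin 5) ≠ 2 by decide)]
  norm_num

/-- `∂₃ g = 7X₃⁶`. [folklore] -/
theorem pderiv_three_gxz {A : Type*} [CommRing A] :
    pderiv 3 (X 2 ^ 2 + X 0 ^ 2 * X 4 ^ 4 + (X 1 ^ 2 + X 0 ^ 3) ^ 3 + X 3 ^ 7 : MvPolynomial (Fin 5) A) = 7 * X 3 ^ 6 := by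
  simp only [map_add, Derivation.leibniz, pderiv_pow, pderiv_X_self, smul_eq_mul,
    pderiv_X_of_ne (show (0 : Fin 5) ≠ 3 by decide), pderiv_X_of_ne (show (1 : Fin 5) ≠ 3 by decide),
    pderiv_X_of_ne (show (2 : Fin 5) ≠ 3 by decide), pderiv_X_of_ne (show (4 : Fin 5) ≠ 3 by decide)]
  norm_num

/-- `∂₄ g = 4X₀²X₄³`. [folklore] -/
theorem pderiv_four_gxz {A : Type*} [CommRing A] :
    pderiv 4 (X 2 ^ 2 + X 0 ^ 2 * X 4 ^ 4 + (X 1 ^ 2 + X 0 ^ 3) ^ 3 + X 3 ^ 7 : MvPolynomial (Fin 5) A) =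
      4 * X 0 ^ 2 * X 4 ^ 3 := by
  simp only [map_add, Derivation.leibniz, pderiv_pow, pderiv_X_self, smul_eq_mul,
    pderiv_X_of_ne (show (0 : Fin 5) ≠ 4 by decide), pderiv_X_of_ne (show (1 : Fin 5) ≠ 4 by decide),
    pderiv_X_of_ne (show (2 : Fin 5) ≠ 4 by decide), pderiv_X_of_ne (show (3 : Fin 5) ≠ 4 by decide)]
  norm_num
  ring

end Summit.ResolutionOfSingularities.ResolutionOfSingularities.Theorems.FInjectiveMacaulayfication.GxzData

end
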